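import Summits.QuantumFields.YangMills.Theorems.BalabanUVNodesK0RecordFormatNames
import Literature.MathematicalPhysics.QuantumFieldTheory.Balaban1983to89.Node00.ZeroInputStepT
import Literature.MathematicalPhysics.QuantumFieldTheory.Balaban1983to89.Node00.Record13Ax

/-!
# K0⁷ — THE RECORD-SIDE FORMAT NAMES, EDITION 11 = **[Ax-4]**: the block-axial-centred instances `…Ax` of `Φf` and of the generic Π-layer (§19),
# and the zero-input twin `recordΦzAx` — a LEAF module of the names file `BalabanUVNodesK0RecordFormatNames` (same namespace, so every name below is
# `Summit.QuantumFields.YangMills.Theorems.K0RecordFormatNames.<name>` exactly as announced)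

Cell `ym-nodeO-ideate`, DEFINER seat `ym-nodeO-def-1` (gen 34), on the port lead's SUMMON (nodeO STATUS 2026-08-31T00:03:15Z; SUMMON-CONDITIONS v3 (1):
[Ax-3a] `Node00/Record13Ax.lean` ✓p797092 ACCEPTED); CRIT-1 g33 RULING Q-3 «CHOICE CHANNEL» ∕ repair (R-C) (nodeO STATUS l.3794), director-ym №460–№468,
port-lead ORDER O-1 (3) ∕ LEDGER v3.0 N-12; typer-1 g2's `recordΦzAx` text (l.3773); `--kind definition --supports stmt-QuantumFields-20541 --as helper`;
count-neutral.  [I] = [Balaban1987RG1], [II] = [Balaban1988RG2Cluster].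

WHY A LEAF MODULE AND NOT §20 OF THE NAMES FILE.  The names file (v10, §1–§19) has 982 lines; the gate caps statement-only files at 1000 lines
(`lint.statement-form`, dry-run 2026-08-31T00:1xZ on the 1055-line append); so edition 11 is THIS file, which imports the names file and the two new
Literature inputs (`Node00.ZeroInputStepT`, `Node00.Record13Ax`) — the names file's own import cone is NOT widened, and the thirteen port files that import it
do not rebuild.  Consumers of the Ax names add ONE import: `Summits.QuantumFields.YangMills.Theorems.BalabanUVNodesK0RecordFormatNamesAx`.

WHAT THIS FILE IS (definitions only; statement-form):
* `recordTermsAx F a₀ ε₂₉` — the record's merged term family (1.6) with the (2.9) cut-off RE-CENTRED at print's block-axial critical configuration: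
  `recordTerms` (§18) with the ONE token `chiβOfRecord₁₃ ↦ chiβOfRecord₁₃Ax` ([Ax-3a]).
* `recordZeroTermsAx F a₀ ε₂₉` — its ZERO-INPUT twin (typer-1's `ZeroInput.zeroInputMergedTermFamilyMatT`, [II] p.21 `𝓝⁰_{k+1}`), same cut-off.
* `recordΦfAx ∕ recordΦzAx` — `ΦfOf F (recordTermsAx …) θfill.ρ8` ∕ `ΦfOf F (recordZeroTermsAx …) θfill.ρ8` on `recordW F a₀ ε₂₉ k K` (the two functionals
  27930⁸ ∕ 26648 v4Ax are cut over; `recordΦfAx` is DEFINITIONALLY `recordΦf` (§9 :328) with the one token swapped — `rfl` receipt in the lemma file).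
* `recordPvolAx ∕ recordPlimAx ∕ recordPkAx ∕ recordPℓAx ∕ recordBetaFlowAx ∕ RecordPiHoloAtAx ∕ RecordPiHoloUniformAx` — ONE-LINERS: the §19 generic Π-layer
  (`pvolOf ∕ plimOf ∕ pkOf ∕ pℓOf ∕ betaFlowOf ∕ PiHoloAtOf ∕ PiHoloUniformOf`) instantiated at `(recordTermsAx F a₀ ε₂₉, θfill.ρ8, θfill.bV)`.
The χ-free names (`recordW`, `recordEmbJ`, `recordGkAt`, `recordLabel₀∕₁`, `recordHn`, `recordCStrip`, every J∕Ctr token, `thetaFill`, `recordK₀`) have no twins.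
The bare `recordΦz` (choice-centred zero-input functional) is NOT filed (CRIT-1 Q-3).  The faces (`recordXAx = XOf … (recordTermsAx …)` `rfl` ×8, the on-the-box
identity `betaOfRecord₁₃Ax F 2 (thetaFill …) k v = secondMoment (recordPlimAx … k v) 0 1`, θ-blindness, the `PiHoloSource` join and the tower-free β-box over
`RecordPiHoloUniformAx`) go to the lemma files (proof kind), not here.

HONEST FRAMING.  Definitions only; NOTHING of Bałaban is asserted, ported or discharged; 27930⁸ ∕ 26648 v4Ax UNSIGNED at filing, 27931⁷ signed-open,
27932 closed by a format-row theorem; stub 2′ OPEN; K0⁷ `Record13SepCoPHInhabited` NOT closed and, AS VETTED, K0⁷∕K1⁹∕K3⁸ read the choice-centred (2.9)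
cut-off (RESTATE v2 pre-authorised №468, not done); NODE O not inhabited (0∕1); COUNT 8∕28 · K 1∕4 UNMOVED; finite `𝕋⁴_{L^K}` at fixed ε — NOT continuum ∕ ℝ⁴ ∕ OS;
**the Yang–Mills mass gap (Clay) is NOT proved by any of this.**  No `sorry`, `instance`, `notation`; standard axioms.
-/

noncomputable section

open scoped BigOperators Matrix.Norms.L2Operator

namespace Summit.QuantumFields.YangMills.Theorems.K0RecordFormatNames

open Literature.MathematicalPhysics.QuantumFieldTheory.Balaban1983to89
open Literature.MathematicalPhysics.QuantumFieldTheory.Balaban1983to89.Node00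
open Literature.MathematicalPhysics.QuantumFieldTheory.Balaban1983to89.T4Continuum (T4Family)
open NormedSpace (exp)

variable (F : T4Family)

/-! ## §20  (v11, **[Ax-4]** of CRIT-1 g33 RULING Q-3 «CHOICE CHANNEL» ∕ repair (R-C), nodeO STATUS l.3794; director-ym №460–№467; port-lead ORDER O-1 (3))
THE BLOCK-AXIAL-CENTRED INSTANCES `…Ax` of the generic Π-layer (§19) and of `Φf`: every name that reads the (2.9) cut-off re-pointed to print's
block-axial-centred `chiβOfRecord₁₃Ax` ([Ax-3]); plus typer-1 g2's zero-input twin `recordΦzAx` (l.3773; the bare `recordΦz` is NOT filed, Q-3).  The χ-free names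
(`recordW`, `recordEmbJ`, `recordGkAt`, `recordLabel₀∕₁`, `recordHn`, `recordCStrip`, all J∕Ctr tokens, `thetaFill`, `recordK₀`) have no twins. [cite: Balaban1987RG1, (2.2)–(2.3) p.265, (2.9) p.266, (1.6) p.261, (1.20)–(1.22) p.264] -/

/-- **The record's merged term family over the block-axial-centred cut-off** (`recordTerms` with `chiβOfRecord₁₃ ↦ chiβOfRecord₁₃Ax`). [cite: Balaban1987RG1, (1.6) p.261, (2.13) p.268, (2.9) p.266] -/
def recordTermsAx (a₀ ε₂₉ : ℝ) : TermFamily1 F (MatA 2) :=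
  mergedTermFamilyMatT F 2 (TβOfRecord₁₃ F 2) (chiβOfRecord₁₃Ax F 2 (thetaFill F a₀ ε₂₉)) (thetaFill F a₀ ε₂₉).εbg

/-- **The record's ZERO-INPUT term family over the block-axial-centred cut-off** (lens-2 D𝓝⁰ ∕ typer-1 `ZeroInput.zeroInputMergedTermFamilyMatT`; CRIT-1 K1″: the same step
functional `ZeroInput.stepOutT` at zero input, `ZeroInput.zeroInputMergedTermT_eq_stepOut` rfl). [cite: Balaban1987RG1, (1.6) p.261; Balaban1988RG2Cluster, p.21] -/
def recordZeroTermsAx (a₀ ε₂₉ : ℝ) : TermFamily1 F (MatA 2) :=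
  ZeroInput.zeroInputMergedTermFamilyMatT F 2 (TβOfRecord₁₃ F 2) (chiβOfRecord₁₃Ax F 2 (thetaFill F a₀ ε₂₉)) (thetaFill F a₀ ε₂₉).εbg

/-- **`Φf` over the block-axial-centred cut-off — `recordΦfAx F a₀ ε₂₉ k v`** = `ΦfOf F (recordTermsAx …) θfill.ρ8` (definitionally `recordΦf` :328 with the ONE token
`chiβOfRecord₁₃ ↦ chiβOfRecord₁₃Ax`; `rfl` receipt in the lemma file). [cite: Balaban1987RG1, (1.6) p.261, (1.20) p.264, (2.9) p.266] -/
def recordΦfAx (a₀ ε₂₉ : ℝ) (k : ℕ) (v : Fin (k + 1) → ℝ) (K : ℕ) : recordW F a₀ ε₂₉ k K → ℂ :=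
  letI θ := thetaFill F a₀ ε₂₉
  letI := θ.instVβ₁; letI := θ.instVβ₂
  ΦfOf F (recordTermsAx F a₀ ε₂₉) θ.ρ8 k v K

/-- **`Φz` — `recordΦzAx F a₀ ε₂₉ k v`**: the record's ZERO-INPUT one-step output family `B ↦ 𝓝⁰_{k+1}(exp ρ₈ B)` on `T_K` = `ΦfOf F (recordZeroTermsAx …) θfill.ρ8`
(typer-1 g2 l.3773 text, over the Ax χ). [cite: Balaban1987RG1, (1.6) p.261, (1.20) p.264; Balaban1988RG2Cluster, p.21] -/
def recordΦzAx (a₀ ε₂₉ : ℝ) (k : ℕ) (v : Fin (k + 1) → ℝ) (K : ℕ) : recordW F a₀ ε₂₉ k K → ℂ :=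
  letI θ := thetaFill F a₀ ε₂₉
  letI := θ.instVβ₁; letI := θ.instVβ₂
  ΦfOf F (recordZeroTermsAx F a₀ ε₂₉) θ.ρ8 k v K

/-- (1.20)–(1.21)₁ at finite volume over the Ax cut-off. [cite: Balaban1987RG1, (1.20)–(1.21) p.264] -/
def recordPvolAx (a₀ ε₂₉ : ℝ) (k : ℕ) (v : Fin (k + 1) → ℝ) (K : ℕ) : B12Beta.Kernel 4 :=
  letI θ := thetaFill F a₀ ε₂₉
  letI := θ.instVβ₁; letI := θ.instVβ₂; letI := θ.instιβ
  pvolOf F (recordTermsAx F a₀ ε₂₉) θ.ρ8 θ.bV k v K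

/-- (1.21) limiting kernel over the Ax cut-off; ON THE BOX it carries `betaOfRecord₁₃Ax (thetaFill …)`. [cite: Balaban1987RG1, (1.21)–(1.22) p.264] -/
def recordPlimAx (a₀ ε₂₉ : ℝ) (k : ℕ) (v : Fin (k + 1) → ℝ) : B12Beta.Kernel 4 :=
  letI θ := thetaFill F a₀ ε₂₉
  letI := θ.instVβ₁; letI := θ.instVβ₂; letI := θ.instιβ
  plimOf F (recordTermsAx F a₀ ε₂₉) θ.ρ8 θ.bV k v

/-- `Π^{(k+1)}(g, ·)` over the Ax cut-off — the `Pk` slot by name. [cite: Balaban1987RG1, (5.42) p.297, (1.22) p.264] -/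
def recordPkAx (a₀ ε₂₉ : ℝ) (k : ℕ) (v : Fin (k + 1) → ℝ) : ℝ → B12Beta.Kernel 4 :=
  letI θ := thetaFill F a₀ ε₂₉
  letI := θ.instVβ₁; letI := θ.instVβ₂; letI := θ.instιβ
  pkOf F (recordTermsAx F a₀ ε₂₉) θ.ρ8 θ.bV k v

/-- `Pℓ` over the Ax cut-off. [cite: Balaban1987RG1, (1.21)–(1.22) p.264] -/
def recordPℓAx (a₀ ε₂₉ : ℝ) (k : ℕ) (v : Fin (k + 1) → ℝ) : ℝ → (Fin 4 → ℤ) → ℂ :=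
  letI θ := thetaFill F a₀ ε₂₉
  letI := θ.instVβ₁; letI := θ.instVβ₂; letI := θ.instιβ
  pℓOf F (recordTermsAx F a₀ ε₂₉) θ.ρ8 θ.bV k v

/-- The (5.42) flow of record over the Ax cut-off (`beta_eq` by construction). [cite: Balaban1987RG1, (5.42) p.297, (0.20) p.256] -/
def recordBetaFlowAx (a₀ ε₂₉ : ℝ) (w : ℕ → ℝ) : Flow :=
  letI θ := thetaFill F a₀ ε₂₉
  letI := θ.instVβ₁; letI := θ.instVβ₂; letI := θ.instιβ
  betaFlowOf F (recordTermsAx F a₀ ε₂₉) θ.ρ8 θ.bV w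

/-- RECEIPT «Π-holomorphy at the record» over the Ax cut-off. Asserts nothing. [cite: Balaban1987RG1, (5.10) p.293, (5.42) p.297] -/
def RecordPiHoloAtAx (a₀ ε₂₉ : ℝ) (k : ℕ) (v : Fin (k + 1) → ℝ) (U : Set ℂ) (γ C δ₁ : ℝ) : Prop :=
  letI θ := thetaFill F a₀ ε₂₉
  letI := θ.instVβ₁; letI := θ.instVβ₂; letI := θ.instιβ
  PiHoloAtOf F (recordTermsAx F a₀ ε₂₉) θ.ρ8 θ.bV k v U γ C δ₁

/-- RECEIPT «Π-holomorphy at the record, uniformly» over the Ax cut-off (ONE (r, C, δ₁) ∀ k, v). Asserts nothing. [cite: Balaban1987RG1, p.263–264, (5.10) p.293] -/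
def RecordPiHoloUniformAx (a₀ ε₂₉ γ r C δ₁ : ℝ) : Prop :=
  letI θ := thetaFill F a₀ ε₂₉
  letI := θ.instVβ₁; letI := θ.instVβ₂; letI := θ.instιβ
  PiHoloUniformOf F (recordTermsAx F a₀ ε₂₉) θ.ρ8 θ.bV γ r C δ₁

end Summit.QuantumFields.YangMills.Theorems.K0RecordFormatNames

end
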